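import Summits.CriticalPhenomena.PercolationContinuityZ3.Theorems.Transplant.SiteUnfoldTools
import HarnessLib

/-!
# SITE percolation: LEMMA U of the site conditioned slack hierarchy, general `k` — the world term of ONE decoy
# (Markov at `C_Y`, dead decoys drop out, Markov at `C_d`, site Lemma Φ(a), centring at the decoy constant)
# (WP6 of P1-SITE-Z3 §12/§15; site twin of `Theorems/PercNearOneGluingNoHeavyLowerTailCSHUnfoldDecoy.lean`)

builds on p205010 (kernel theorem, internal audit signed; external expert review pending).

Sum level (`BHK2006.weight`, `Σ weight = 1`); site worlds delete `SiteCSH.worldDead Γ Y ζ`; vocabulary of `SiteUnfoldTools` (p214462: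
`avoid`, `wcovOff`, `markov_merge_Y`, `residual_orthogonal`) and of the model-free level-form algebra `CSH.chi/av/slForm` (`…CSHLevelForms.lean`)
fed with the site relation `a b ↦ b ∈ C_a(ζ)`.  For the owner `x`, avoided set `Y`, source set `S ∋ x`, a decoy `d` with avoidance event
`E = {d ↮ S ∪ Y}` (masses `m₀`, `m₁(w')`, constant `c = m₁/m₀`), later decoys `L'`, a marker `u`, and a vertex-cluster functional `g`:
* `world_term_alive` / `world_term_dead` — in the site world a decoy outside `C_Y` keeps its indicators, a decoy inside `C_Y` has an EMPTY
  cluster (site simplification: no side conditions `d ∉ S`, `u ≠ d`, `d ∉ L'`);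
* `resid` (`Θ = 1{x↮Y}(g(C_x) − ḡ)`), `phiS` (`Φ(C_d)` with the deleted set `worldDead_{d}` = `{d} ∪ C_d ∪ ∂C_d`), `resid_world_singleton`,
  `sum_resid_world_singleton` (site Lemma Φ(a) in residual form), `sum_resid_mul_clusterFn` (Markov at `C_d`), `sum_resid_decoy_moment`;
* **`decoy_world_term`**: `Σ_ω w 1{x↮Y} Cov_{world(ω)}(g(C_x), ε(d)·sl_{L'}[χ_d − c](u)) = −m₀⁻¹ · sl_{L'}[w' ↦ m₀·P₁(w') − m₁(w')·P₀](u)`.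
Definitions + proofs (`--supports stmt-CriticalPhenomena-4575 --as helper`); no named facts, no sorries.
[cite: VandenbergHaggstromKahn2005, §2.1 Lemma 2.4 (p. 10); §1 display (10) (pp. 7–8)] [cite: KozmaNitzan2024, Conj. 4 (p. 32)]
-/

noncomputable section

namespace Summit.CriticalPhenomena.PercolationContinuityZ3.Theorems.Transplant

namespace SiteCSH

open MeasureTheory Set
open Literature.Probability.Percolation
open Literature.Probability.Percolation.BHK2006 (weight weight_nonneg ind_inter integral_prodBernoulli_eq_sum)
open Literature.Probability.Percolation.DecisionTree (ind ind_of_mem ind_of_not_mem ind_nonneg)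
open Literature.Probability.LatticeModels (prodBernoulli prodBernoulli_real_pos_of_nonempty)
open Summit.CriticalPhenomena.PercolationContinuityZ3.Theorems.CSH (slForm slForm_smul slForm_eq_sum_single cshMarg
  cshMarg_eq_sum_single slForm_jn jn_singleton)
open Summit.CriticalPhenomena.PercolationContinuityZ3.Theorems.SiteTransplant (siteConn)
open SiteGen (siteCluster_mono' siteCluster_eq_of_mem mem_siteConn_iff_mem_siteCluster)
open SiteBHK (setC)
open scoped Classical

variable {V : Type*} {Γ : SimpleGraph V}

/-! ### World indicators of a decoy: alive (outside `C_Y`) = global; dead (inside `C_Y`) = empty cluster -/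

/-- Alive decoy: the world term `ε(d)·sl_{L'}[χ_d − c](u)` equals `1{d ↮ S}(ζ) · sl_{L'}[1{d ↔ ·}(ζ) − c](u)` (global indicators).
[cite: VandenbergHaggstromKahn2005, §2.1 Lemma 2.4 (p. 10) — corollary] -/
theorem world_term_alive {ζ : Set V} {Y : Set V} {d : V} (h : ζ ∈ avoid Γ d Y) (S : Set V)
    (L' : List (V × (V → ℝ))) (c : V → ℝ) (u : V) :
    CSH.av (fun a b => b ∈ siteCluster Γ (ζ \ worldDead Γ Y ζ) a) S d *
        slForm L' (fun w' => CSH.chi (fun a b => b ∈ siteCluster Γ (ζ \ worldDead Γ Y ζ) a) w' d - c w') u =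
      ind (avoid Γ d S) ζ * slForm L' (fun w' => ind (siteConn Γ d w') ζ - c w') u := by
  have hC : siteCluster Γ (ζ \ worldDead Γ Y ζ) d = siteCluster Γ ζ d := siteCluster_world_of_avoid h
  have hiff : ∀ w', d ∈ siteCluster Γ (ζ \ worldDead Γ Y ζ) w' ↔ d ∈ siteCluster Γ ζ w' := by
    intro w'
    constructor
    · intro h'
      have h1 : w' ∈ siteCluster Γ ζ d := by rw [← hC]; exact siteRel_symm _ _ _ h'
      exact siteRel_symm ζ _ _ h1
    · intro h'
      have h1 : w' ∈ siteCluster Γ (ζ \ worldDead Γ Y ζ) d := by rw [hC]; exact siteRel_symm ζ _ _ h'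
      exact siteRel_symm _ _ _ h1
  have hfun : (fun w' => CSH.chi (fun a b => b ∈ siteCluster Γ (ζ \ worldDead Γ Y ζ) a) w' d - c w') =
      fun w' => ind (siteConn Γ d w') ζ - c w' := by
    funext w'
    rw [← chi_rel_eq_ind ζ w' d]
    simp only [CSH.chi, hiff]
  have hav : CSH.av (fun a b => b ∈ siteCluster Γ (ζ \ worldDead Γ Y ζ) a) S d = ind (avoid Γ d S) ζ := by
    rw [← av_rel_eq_ind ζ S d]
    simp only [CSH.av, hC]
  rw [hfun, hav]

/-- Dead decoy: the world term `ε(d)·sl_{L'}[χ_d − c](u)` is the CONFIGURATION-FREE number `−sl_{L'}[c](u)` (in the site world a dead decoy has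
an empty cluster, so every `χ_d` vanishes and `ε(d) = 1`; no side condition). [cite: VandenbergHaggstromKahn2005, §2.1 Lemma 2.4 (p. 10) — corollary] -/
theorem world_term_dead {ζ : Set V} {Y : Set V} {d : V} (h : ζ ∉ avoid Γ d Y) (S : Set V)
    (L' : List (V × (V → ℝ))) (c : V → ℝ) (u : V) :
    CSH.av (fun a b => b ∈ siteCluster Γ (ζ \ worldDead Γ Y ζ) a) S d *
        slForm L' (fun w' => CSH.chi (fun a b => b ∈ siteCluster Γ (ζ \ worldDead Γ Y ζ) a) w' d - c w') u = - slForm L' c u := by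
  have hC : siteCluster Γ (ζ \ worldDead Γ Y ζ) d = ∅ := siteCluster_world_eq_empty_of_not_avoid h ζ
  have hav : CSH.av (fun a b => b ∈ siteCluster Γ (ζ \ worldDead Γ Y ζ) a) S d = 1 := by
    simp only [CSH.av, hC, mem_empty_iff_false, not_false_eq_true, implies_true, if_true]
  have hchi : ∀ w', CSH.chi (fun a b => b ∈ siteCluster Γ (ζ \ worldDead Γ Y ζ) a) w' d = 0 := by
    intro w'
    simp only [CSH.chi]
    rw [if_neg]
    intro h'
    have h1 : w' ∈ siteCluster Γ (ζ \ worldDead Γ Y ζ) d := siteRel_symm _ _ _ h'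
    rw [hC] at h1
    exact h1
  have hsl : (fun w' => CSH.chi (fun a b => b ∈ siteCluster Γ (ζ \ worldDead Γ Y ζ) a) w' d - c w') = (-1 : ℝ) • c := by
    funext w'; rw [hchi w', Pi.smul_apply, smul_eq_mul]; ring
  rw [hav, one_mul, hsl, slForm_smul, Pi.smul_apply, smul_eq_mul]
  ring

/-! ### The residual `Θ` and the Lemma-Φ functional at the cluster of a decoy (sum level) -/

variable [Fintype V]

variable (Γ) in
/-- **The telescoping residual** `Θ(ζ) = 1{x ↮ Y}(ζ)·(g(C_x(ζ)) − ḡ(ζ))`, `ḡ` the site world mean. [cite: VandenbergHaggstromKahn2005, §2.1 Lemma 2.4 (p. 10)] -/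
def resid (w : V → ℝ) (x : V) (Y : Set V) (g : Set V → ℝ) (ζ : Set V) : ℝ :=
  ind (avoid Γ x Y) ζ * (g (siteCluster Γ ζ x) - wmeanOff Γ w Y (fun β => g (siteCluster Γ β x)) ζ)

variable (Γ) in
/-- **`Φ(C_d(ζ))`**, sum level: the site Lemma-Φ functional `Σ_η w I_D(η)` with the deleted set `D = worldDead_{d}(ζ) = {d} ∪ C_d ∪ ∂C_d`
(the site world of the explored cluster of the decoy). [cite: VandenbergHaggstromKahn2005, §2.1 Lemma 2.4 (p. 10)] -/
def phiS (w : V → ℝ) (x : V) (Y : Set V) (g : Set V → ℝ) (d : V) (ζ : Set V) : ℝ :=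
  ∑ η, weight w η * phiIntegrand Γ x Y (worldDead Γ {d} ζ) g η

/-- Exploring the cluster of a decoy avoiding `{x} ∪ Y` does not change the residual `Θ`. [folklore] -/
theorem resid_world_singleton (w : V → ℝ) {x : V} {Y : Set V} (g : Set V → ℝ) {d : V} {ζ : Set V}
    (h : ζ ∈ avoid Γ d (insert x Y)) : resid Γ w x Y g (ζ \ worldDead Γ {d} ζ) = resid Γ w x Y g ζ := by
  have hdY : ζ ∈ avoid Γ d Y := fun y hy => h y (mem_insert_of_mem x hy)
  have hxd : ζ ∈ avoid Γ x {d} := fun t ht => by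
    rw [mem_singleton_iff] at ht; subst ht
    exact fun hr => h x (mem_insert x Y) (siteRel_symm ζ _ _ hr)
  unfold resid
  have e1 : siteCluster Γ (ζ \ worldDead Γ {d} ζ) x = siteCluster Γ ζ x := siteCluster_world_of_avoid hxd
  have e2 : wmeanOff Γ w Y (fun β => g (siteCluster Γ β x)) (ζ \ worldDead Γ {d} ζ) =
      wmeanOff Γ w Y (fun β => g (siteCluster Γ β x)) ζ := by
    unfold wmeanOff; rw [worldDead_world_singleton_of_avoid hdY]
  have e3 : ind (avoid Γ x Y) (ζ \ worldDead Γ {d} ζ) = ind (avoid Γ x Y) ζ := by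
    by_cases hx : ζ ∈ avoid Γ x Y
    · rw [ind_of_mem hx, ind_of_mem (show ζ \ worldDead Γ {d} ζ ∈ avoid Γ x Y from
        fun y hy hr => hx y hy (by rwa [e1] at hr))]
    · rw [ind_of_not_mem hx, ind_of_not_mem (show ζ \ worldDead Γ {d} ζ ∉ avoid Γ x Y from
        fun h' => hx fun y hy hr => h' y hy (by rwa [e1]))]
  rw [e1, e2, e3]

/-- **Site Lemma Φ(a) in residual form**: the world mean of `Θ` off the explored cluster of `d` is `−Φ(C_d)`:
`Σ_η w(η) Θ(η ∖ worldDead_{d} ζ) = −Φ(C_d(ζ))`. [cite: VandenbergHaggstromKahn2005, §2.1 Lemma 2.4 (p. 10)] -/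
theorem sum_resid_world_singleton (w : V → ℝ) (hm : ∑ ω, weight w ω = 1) (x : V) (Y : Set V)
    (g : Set V → ℝ) (d : V) (ζ : Set V) :
    ∑ η, weight w η * resid Γ w x Y g (η \ worldDead Γ {d} ζ) = - phiS Γ w x Y g d ζ := by
  unfold phiS
  rw [sum_phiIntegrand_eq w hm x Y (worldDead Γ {d} ζ) g, ← Finset.sum_neg_distrib]
  refine Finset.sum_congr rfl fun η _ => ?_
  unfold resid avoid; ring

/-- The cluster of the source set `{d}` on the whole graph is the site cluster of `d`. [folklore] -/
theorem setC_singleton_univ (d : V) (ζ : Set V) : setC Γ Finset.univ ({d} : Set V) ζ = siteCluster Γ ζ d := by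
  ext u; simp only [SiteBHK.mem_setC, mem_singleton_iff, exists_eq_left, SiteBHK.sC_univ]

/-- **Markov at the cluster of a decoy + site Lemma Φ(a)**: for every function `f` of the site cluster of `d` and every avoided set
`A ⊇ {x} ∪ Y`:  `Σ_ζ w Θ(ζ)·1{d ↮ A}(ζ)·f(C_d(ζ)) = −Σ_ζ w 1{d ↮ A}(ζ)·f(C_d(ζ))·Φ(C_d(ζ))`.
[cite: VandenbergHaggstromKahn2005, §2.1 Lemma 2.4 (p. 10) — corollary] -/
theorem sum_resid_mul_clusterFn (w : V → ℝ) (hm : ∑ ω, weight w ω = 1) (x : V) (Y : Set V)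
    (g : Set V → ℝ) (d : V) {A : Set V} (hA : insert x Y ⊆ A) (f : Set V → ℝ) :
    ∑ ζ, weight w ζ * (resid Γ w x Y g ζ * (ind (avoid Γ d A) ζ * f (siteCluster Γ ζ d))) =
      - ∑ ζ, weight w ζ * (ind (avoid Γ d A) ζ * f (siteCluster Γ ζ d) * phiS Γ w x Y g d ζ) := by
  set K : Set V → Set V → ℝ := fun W β => (if (∀ a ∈ A, a ∉ W) then 1 else 0) * f W * resid Γ w x Y g β with hK
  have key := set_sum_cond w hm ({d} : Set V) K (Γ := Γ)
  simp only [setC_singleton_univ] at key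
  have hind : ∀ ζ : Set V, ind (avoid Γ d A) ζ = if (∀ a ∈ A, a ∉ siteCluster Γ ζ d) then 1 else 0 := by
    intro ζ
    by_cases h : ζ ∈ avoid Γ d A
    · rw [ind_of_mem h, if_pos (show ∀ a ∈ A, a ∉ siteCluster Γ ζ d from h)]
    · rw [ind_of_not_mem h, if_neg (show ¬ ∀ a ∈ A, a ∉ siteCluster Γ ζ d from h)]
  have hL : ∀ ζ, weight w ζ * K (siteCluster Γ ζ d) (ζ \ worldDead Γ {d} ζ) =
      weight w ζ * (resid Γ w x Y g ζ * (ind (avoid Γ d A) ζ * f (siteCluster Γ ζ d))) := by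
    intro ζ
    simp only [hK]
    rw [← hind]
    by_cases h : ζ ∈ avoid Γ d A
    · rw [resid_world_singleton w g (fun a ha => h a (hA ha))]; ring
    · rw [ind_of_not_mem h]; ring
  have hR : ∀ ζ, weight w ζ * ∑ η, weight w η * K (siteCluster Γ ζ d) (η \ worldDead Γ {d} ζ) =
      - (weight w ζ * (ind (avoid Γ d A) ζ * f (siteCluster Γ ζ d) * phiS Γ w x Y g d ζ)) := by
    intro ζ
    simp only [hK]
    rw [← hind]
    have e : ∑ η, weight w η * (ind (avoid Γ d A) ζ * f (siteCluster Γ ζ d) * resid Γ w x Y g (η \ worldDead Γ {d} ζ)) =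
        ind (avoid Γ d A) ζ * f (siteCluster Γ ζ d) * ∑ η, weight w η * resid Γ w x Y g (η \ worldDead Γ {d} ζ) := by
      rw [Finset.mul_sum]; exact Finset.sum_congr rfl fun η _ => by ring
    rw [e, sum_resid_world_singleton w hm x Y g d ζ]; ring
  calc _ = ∑ ζ, weight w ζ * K (siteCluster Γ ζ d) (ζ \ worldDead Γ {d} ζ) :=
        Finset.sum_congr rfl fun ζ _ => (hL ζ).symm
    _ = ∑ ζ, weight w ζ * ∑ η, weight w η * K (siteCluster Γ ζ d) (η \ worldDead Γ {d} ζ) := key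
    _ = ∑ ζ, - (weight w ζ * (ind (avoid Γ d A) ζ * f (siteCluster Γ ζ d) * phiS Γ w x Y g d ζ)) :=
        Finset.sum_congr rfl fun ζ _ => hR ζ
    _ = _ := by rw [Finset.sum_neg_distrib]

/-! ### Centring at the decoy constant -/

/-- **The centred decoy moment** (denominator-free): with `E = {d ↮ A}` (`A ⊇ {x} ∪ Y`), `m₀ = μ(E) ≠ 0`, `m₁ = μ(E ∩ {d↔w'})`, `c = m₁/m₀`,
`P₁ = Σ w 1_E 1{d↔w'} Φ(C_d)`, `P₀ = Σ w 1_E Φ(C_d)`: `Σ_ζ w Θ·1_E·(1{d↔w'} − c) = −m₀⁻¹·(m₀ P₁ − m₁ P₀)`.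
[cite: VandenbergHaggstromKahn2005, §2.1 Lemma 2.4 (p. 10) — corollary] -/
theorem sum_resid_decoy_moment (w : V → ℝ) (hm : ∑ ω, weight w ω = 1) (x : V) (Y : Set V)
    (g : Set V → ℝ) (d : V) {A : Set V} (hA : insert x Y ⊆ A) (w' : V) {c : ℝ}
    (hm₀ : ∑ ζ, weight w ζ * ind (avoid Γ d A) ζ ≠ 0)
    (hc : c = (∑ ζ, weight w ζ * ind (avoid Γ d A ∩ siteConn Γ d w') ζ) / ∑ ζ, weight w ζ * ind (avoid Γ d A) ζ) :
    ∑ ζ, weight w ζ * (resid Γ w x Y g ζ * (ind (avoid Γ d A) ζ * (ind (siteConn Γ d w') ζ - c))) =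
      - ((∑ ζ, weight w ζ * ind (avoid Γ d A) ζ)⁻¹ *
          ((∑ ζ, weight w ζ * ind (avoid Γ d A) ζ) *
              (∑ ζ, weight w ζ * (ind (avoid Γ d A ∩ siteConn Γ d w') ζ * phiS Γ w x Y g d ζ)) -
            (∑ ζ, weight w ζ * ind (avoid Γ d A ∩ siteConn Γ d w') ζ) *
              (∑ ζ, weight w ζ * (ind (avoid Γ d A) ζ * phiS Γ w x Y g d ζ)))) := by
  -- the test function as a function of the site cluster of `d`
  set f : Set V → ℝ := fun K => (if w' ∈ K then (1 : ℝ) else 0) - c with hf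
  have hfK : ∀ ζ : Set V, f (siteCluster Γ ζ d) = ind (siteConn Γ d w') ζ - c := by
    intro ζ
    simp only [hf]
    by_cases h : ζ ∈ siteConn Γ d w'
    · rw [ind_of_mem h, if_pos ((mem_siteConn_iff_mem_siteCluster Γ d w' ζ).1 h)]
    · rw [ind_of_not_mem h, if_neg (fun h' => h ((mem_siteConn_iff_mem_siteCluster Γ d w' ζ).2 h'))]
  have h1 := sum_resid_mul_clusterFn (Γ := Γ) w hm x Y g d hA f
  simp only [hfK] at h1
  rw [h1]
  set m₀ := ∑ ζ, weight w ζ * ind (avoid Γ d A) ζ with hm₀'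
  set m₁ := ∑ ζ, weight w ζ * ind (avoid Γ d A ∩ siteConn Γ d w') ζ with hm₁'
  set P₁ := ∑ ζ, weight w ζ * (ind (avoid Γ d A ∩ siteConn Γ d w') ζ * phiS Γ w x Y g d ζ) with hP₁
  set P₀ := ∑ ζ, weight w ζ * (ind (avoid Γ d A) ζ * phiS Γ w x Y g d ζ) with hP₀
  have e : ∑ ζ, weight w ζ * (ind (avoid Γ d A) ζ * (ind (siteConn Γ d w') ζ - c) * phiS Γ w x Y g d ζ) =
      P₁ - c * P₀ := by
    rw [hP₁, hP₀, Finset.mul_sum, ← Finset.sum_sub_distrib]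
    refine Finset.sum_congr rfl fun ζ _ => ?_
    rw [ind_inter]; ring
  rw [e, hc]
  field_simp

/-! ### The world term of one decoy -/

omit [Fintype V] in
/-- `1{d ↮ Y} · 1{d ↮ S} = 1{d ↮ S ∪ Y}`. [folklore] -/
theorem ind_avoid_mul_union (d : V) (S Y : Set V) (ζ : Set V) :
    ind (avoid Γ d Y) ζ * ind (avoid Γ d S) ζ = ind (avoid Γ d (S ∪ Y)) ζ := by
  by_cases hY : ζ ∈ avoid Γ d Y
  · by_cases hS : ζ ∈ avoid Γ d S
    · rw [ind_of_mem hY, ind_of_mem hS, one_mul, ind_of_mem]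
      intro a ha
      rcases ha with ha | ha
      · exact hS a ha
      · exact hY a ha
    · rw [ind_of_mem hY, ind_of_not_mem hS, mul_zero, ind_of_not_mem]
      exact fun h => hS fun a ha => h a (Or.inl ha)
  · rw [ind_of_not_mem hY, zero_mul, ind_of_not_mem]
    exact fun h => hY fun a ha => h a (Or.inr ha)

/-- **THE WORLD TERM OF ONE DECOY (site).**  Data: owner `x`, avoided set `Y`, source set `S ∋ x` (owner + earlier decoys), decoy `d`, later
decoys `L'`, marker `u`, `E = {d ↮ S ∪ Y}`, `m₀ = μ(E) ≠ 0`, `c(w') = μ(E ∩ {d↔w'})/m₀`.  Then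
`Σ_ω w 1{x↮Y} Cov_{world(ω)}(g(C_x), ε(d)·sl_{L'}[χ_d − c](u)) = −m₀⁻¹ · sl_{L'}[w' ↦ m₀·P₁(w') − m₁(w')·P₀](u)`
with `P₁(w') = Σ w 1_E 1{d↔w'} Φ(C_d)`, `P₀ = Σ w 1_E Φ(C_d)` (no side conditions on `d`, `L'`, `u` are needed in the site model).
[cite: VandenbergHaggstromKahn2005, §2.1 Lemma 2.4 (p. 10); §1 display (10) (pp. 7–8) — corollaries] -/
theorem decoy_world_term (w : V → ℝ) (hm : ∑ ω, weight w ω = 1) (x : V) (Y : Set V) (g : Set V → ℝ)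
    {S : Set V} (hxS : x ∈ S) (d : V) (L' : List (V × (V → ℝ))) (u : V) (c : V → ℝ)
    (hm₀ : ∑ ζ, weight w ζ * ind (avoid Γ d (S ∪ Y)) ζ ≠ 0)
    (hc : ∀ w', c w' = (∑ ζ, weight w ζ * ind (avoid Γ d (S ∪ Y) ∩ siteConn Γ d w') ζ) /
      ∑ ζ, weight w ζ * ind (avoid Γ d (S ∪ Y)) ζ) :
    ∑ ω, weight w ω * (ind (avoid Γ x Y) ω *
        wcovOff Γ w Y (fun β => g (siteCluster Γ β x))
          (fun ζ => CSH.av (fun a b => b ∈ siteCluster Γ ζ a) S d *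
            slForm L' (fun w' => CSH.chi (fun a b => b ∈ siteCluster Γ ζ a) w' d - c w') u) ω) =
      - ((∑ ζ, weight w ζ * ind (avoid Γ d (S ∪ Y)) ζ)⁻¹ *
          slForm L' (fun w' =>
            (∑ ζ, weight w ζ * ind (avoid Γ d (S ∪ Y)) ζ) *
                (∑ ζ, weight w ζ * (ind (avoid Γ d (S ∪ Y) ∩ siteConn Γ d w') ζ * phiS Γ w x Y g d ζ)) -
              (∑ ζ, weight w ζ * ind (avoid Γ d (S ∪ Y) ∩ siteConn Γ d w') ζ) *
                (∑ ζ, weight w ζ * (ind (avoid Γ d (S ∪ Y)) ζ * phiS Γ w x Y g d ζ))) u) := by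
  have hA : insert x Y ⊆ S ∪ Y := by
    intro a ha
    rcases mem_insert_iff.1 ha with rfl | ha
    · exact Or.inl hxS
    · exact Or.inr ha
  set G : Set V → ℝ := fun β => g (siteCluster Γ β x) with hG
  set ψ : Set V → ℝ := fun ζ =>
    CSH.av (fun a b => b ∈ siteCluster Γ ζ a) S d *
      slForm L' (fun w' => CSH.chi (fun a b => b ∈ siteCluster Γ ζ a) w' d - c w') u with hψ
  set m₀ := ∑ ζ, weight w ζ * ind (avoid Γ d (S ∪ Y)) ζ with hm₀'
  set Q : V → ℝ := fun w' =>
    m₀ * (∑ ζ, weight w ζ * (ind (avoid Γ d (S ∪ Y) ∩ siteConn Γ d w') ζ * phiS Γ w x Y g d ζ)) -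
      (∑ ζ, weight w ζ * ind (avoid Γ d (S ∪ Y) ∩ siteConn Γ d w') ζ) *
        (∑ ζ, weight w ζ * (ind (avoid Γ d (S ∪ Y)) ζ * phiS Γ w x Y g d ζ)) with hQ
  -- Step 1: world covariance as a centred world mean, and the Markov merge at `C_Y`
  have step1 : ∑ ω, weight w ω * (ind (avoid Γ x Y) ω * wcovOff Γ w Y G ψ ω) =
      ∑ ζ, weight w ζ * (resid Γ w x Y g ζ * ψ (ζ \ worldDead Γ Y ζ)) := by
    have h := markov_merge_Y w hm x Y g ψ (Γ := Γ)
    have lhs : ∀ ω, weight w ω * (ind (avoid Γ x Y) ω * wcovOff Γ w Y G ψ ω) =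
        weight w ω * (ind (avoid Γ x Y) ω * ∑ η, weight w η * ((g (siteCluster Γ (η \ worldDead Γ Y ω) x) -
          wmeanOff Γ w Y (fun β => g (siteCluster Γ β x)) ω) * ψ (η \ worldDead Γ Y ω))) := by
      intro ω; rw [wcovOff_eq_sum]
    rw [Finset.sum_congr rfl (fun ω _ => lhs ω), h]
    refine Finset.sum_congr rfl fun ζ _ => ?_
    unfold resid; ring
  -- Step 2: the world test function in the merged configuration (alive / dead decoy)
  have step2 : ∀ ζ, ψ (ζ \ worldDead Γ Y ζ) =
      ind (avoid Γ d (S ∪ Y)) ζ * slForm L' (fun w' => ind (siteConn Γ d w') ζ - c w') u +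
        (1 - ind (avoid Γ d Y) ζ) * (- slForm L' c u) := by
    intro ζ
    by_cases h : ζ ∈ avoid Γ d Y
    · rw [hψ]
      dsimp only
      rw [world_term_alive h S L' c u, ← ind_avoid_mul_union d S Y ζ, ind_of_mem h]; ring
    · rw [hψ]
      dsimp only
      rw [world_term_dead h S L' c u, ind_of_not_mem h]
      have h0 : ind (avoid Γ d (S ∪ Y)) ζ = 0 := ind_of_not_mem fun h' => h fun y hy => h' y (Or.inr hy)
      rw [h0]; ring
  -- Step 3: the dead part dies against the residual
  have step3 : ∑ ζ, weight w ζ * (resid Γ w x Y g ζ * ((1 - ind (avoid Γ d Y) ζ) * (- slForm L' c u))) = 0 := by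
    have h := residual_orthogonal w hm x Y g
      (fun W => (1 - (if d ∈ W then (0 : ℝ) else 1)) * (- slForm L' c u)) (Γ := Γ)
    rw [← h]
    refine Finset.sum_congr rfl fun ζ _ => ?_
    unfold resid
    rw [ind_avoid_eq_ite d Y ζ]; ring
  -- Step 4: the alive part, by linearity of `sl_{L'}` and the centred decoy moments
  have step4 : ∑ ζ, weight w ζ * (resid Γ w x Y g ζ * (ind (avoid Γ d (S ∪ Y)) ζ *
      slForm L' (fun w' => ind (siteConn Γ d w') ζ - c w') u)) = - (m₀⁻¹ * slForm L' Q u) := by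
    have lin : ∀ ζ, slForm L' (fun w' => ind (siteConn Γ d w') ζ - c w') u =
        ∑ w', slForm L' (Pi.single w' (1 : ℝ)) u * (ind (siteConn Γ d w') ζ - c w') :=
      fun ζ => slForm_eq_sum_single L' _ u
    simp only [lin, Finset.mul_sum]
    rw [Finset.sum_comm]
    have inner : ∀ w', ∑ ζ, weight w ζ * (resid Γ w x Y g ζ * (ind (avoid Γ d (S ∪ Y)) ζ *
        (slForm L' (Pi.single w' (1 : ℝ)) u * (ind (siteConn Γ d w') ζ - c w')))) =
        slForm L' (Pi.single w' (1 : ℝ)) u * (- (m₀⁻¹ * Q w')) := by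
      intro w'
      rw [← sum_resid_decoy_moment w hm x Y g d hA w' hm₀ (hc w'), Finset.mul_sum]
      exact Finset.sum_congr rfl fun ζ _ => by ring
    rw [Finset.sum_congr rfl (fun w' _ => inner w'), slForm_eq_sum_single L' Q u, Finset.mul_sum, ← Finset.sum_neg_distrib]
    exact Finset.sum_congr rfl fun w' _ => by ring
  -- assemble
  rw [step1]
  have split : ∀ ζ, weight w ζ * (resid Γ w x Y g ζ * ψ (ζ \ worldDead Γ Y ζ)) =
      weight w ζ * (resid Γ w x Y g ζ * (ind (avoid Γ d (S ∪ Y)) ζ *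
        slForm L' (fun w' => ind (siteConn Γ d w') ζ - c w') u)) +
      weight w ζ * (resid Γ w x Y g ζ * ((1 - ind (avoid Γ d Y) ζ) * (- slForm L' c u))) := by
    intro ζ; rw [step2 ζ]; ring
  rw [Finset.sum_congr rfl (fun ζ _ => split ζ), Finset.sum_add_distrib, step3, step4, add_zero]

end SiteCSH

end Summit.CriticalPhenomena.PercolationContinuityZ3.Theorems.Transplant
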